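import Summits.Ventures.HodgeRepro2.T5QuotientEquivariance
import Summits.Ventures.HodgeRepro2.T5DoubleCosetTopology
import Mathlib.Algebra.Group.Action.Hom
import Mathlib.Algebra.Group.Subgroup.Actions

/-!
# T5RightCosetAction — (A3) STEP 1: the dictionary `(G(F)\G(𝔸))/K_f = G(F)\G(𝔸)/K_f`

Cell pub-hodge-repro2, seat p5, Tier 5 (route/T5-N4-p5.md, N4.3 (A3) STEP 1, l. 147).  Rows 41–43
identify `L^{K_f}` with `L²` of an ORBIT SPACE `X/K` for a group `K` acting on `X`; rows 39–40 and
p2's rows 30–31 describe the quotient as the DOUBLE COSET SPACE `FullQuotient H K = H\(A × B)/({1} × K)`.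
This file is the dictionary between the two models of `G(F)\G(𝔸)/K_f`:

* `RightCosets H = H\G` (Mathlib's `Quotient (QuotientGroup.rightRel H)`) carries the right regular
  action of `G`, `g • [x] = [x g⁻¹]` (`instMulAction`, measurable for the quotient σ-algebra and
  continuous), restricted to any subgroup `T ≤ G`;
* two subgroups that commute elementwise act commutingly (`smulCommClass_of_commute`), in
  particular `A × {1}` (through `MonoidHom.inl`, `instMulActionInl`) and `{1} × K` on
  `H\(A × B)` (`instSMulCommClass_inl_rightLevel`: «G_∞ commutes with K_f»);
* `orbitEquivDoubleCoset H T : (H\G)/T ≃ H\G/T` (`orbitRel_iff`: two right cosets are in the same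
  `T`-orbit iff they lie in the same double coset), a `MeasurableEquiv` for the quotient σ-algebras
  (`orbitMeasurableEquivDoubleCoset`) and a homeomorphism for the quotient topologies
  (`orbitHomeomorphDoubleCoset`), and `A`-EQUIVARIANT between row 43's induced action on the orbit
  space and row 39's action on `FullQuotient H K` (`orbitEquivDoubleCoset_smul`).

So the `L²`-identification of rows 41–43 and the orbit topology of row 39 are statements about ONE
space.  Mathlib only besides rows 39–43.  Axioms: propext, Classical.choice, Quot.sound.
README §8(d): uses an L-value-free non-vanishing device: NO.
-/

namespace Summit.Ventures.HodgeRepro2.T5RightCosetAction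

open MeasureTheory Topology
open Summit.Ventures.HodgeRepro2.T5DoubleCosetDecomposition

/-! ### The right regular action of `G` on `H\G` -/

section Action

variable {G : Type*} [Group G] (H : Subgroup G)

/-- The right coset space `H\G` (Mathlib's `Quotient (QuotientGroup.rightRel H)`). -/
abbrev RightCosets := Quotient (QuotientGroup.rightRel H)

/-- The class of `x` in `H\G`. -/
abbrev rmk : G → RightCosets H := Quotient.mk''

/-- Two elements define the same right coset iff `y * x⁻¹ ∈ H`. -/
theorem rmk_eq_rmk_iff {x y : G} : rmk H x = rmk H y ↔ y * x⁻¹ ∈ H := by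
  rw [Quotient.eq'', QuotientGroup.rightRel_apply]

/-- The right regular action of `G` on `H\G`: `g • [x] = [x * g⁻¹]`. -/
instance instMulAction : MulAction G (RightCosets H) where
  smul g q := Quotient.liftOn' q (fun x => rmk H (x * g⁻¹)) fun x y hxy => by
    rw [QuotientGroup.rightRel_apply] at hxy
    rw [rmk_eq_rmk_iff, mul_inv_rev, inv_inv, mul_assoc, inv_mul_cancel_left]
    exact hxy
  one_smul q := by
    refine Quotient.inductionOn' q fun x => ?_
    show rmk H (x * (1 : G)⁻¹) = rmk H x
    rw [inv_one, mul_one]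
  mul_smul g g' q := by
    refine Quotient.inductionOn' q fun x => ?_
    show rmk H (x * (g * g')⁻¹) = rmk H (x * g'⁻¹ * g⁻¹)
    rw [mul_inv_rev, mul_assoc]

/-- The action on classes. -/
theorem smul_rmk (g x : G) : g • rmk H x = rmk H (x * g⁻¹) :=
  rfl

/-- The restricted action of a subgroup `T ≤ G` on classes. -/
theorem subgroup_smul_rmk {T : Subgroup G} (t : T) (x : G) : t • rmk H x = rmk H (x * (t : G)⁻¹) :=
  rfl

/-- Subgroups that commute elementwise act commutingly on `H\G`. -/
theorem smulCommClass_of_commute (S T : Subgroup G) (hST : ∀ s ∈ S, ∀ t ∈ T, Commute s t) :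
    SMulCommClass S T (RightCosets H) where
  smul_comm s t q := by
    refine Quotient.inductionOn' q fun x => ?_
    rw [subgroup_smul_rmk, subgroup_smul_rmk, subgroup_smul_rmk, subgroup_smul_rmk, mul_assoc,
      mul_assoc, (hST _ s.2 _ t.2).inv_inv.eq]

/-- Two right cosets are in the same `T`-orbit iff they lie in the same double coset `H x T`. -/
theorem orbitRel_iff (T : Subgroup G) (x y : G) :
    MulAction.orbitRel T (RightCosets H) (rmk H x) (rmk H y) ↔
      DoubleCoset.mk H T x = DoubleCoset.mk H T y := by
  rw [MulAction.orbitRel_apply, MulAction.mem_orbit_iff, DoubleCoset.eq]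
  constructor
  · rintro ⟨⟨t, ht⟩, hxy⟩
    rw [subgroup_smul_rmk, rmk_eq_rmk_iff] at hxy
    refine ⟨(x * t * y⁻¹)⁻¹, H.inv_mem (by simpa [mul_assoc] using hxy), t, ht, ?_⟩
    group
  · rintro ⟨h, hh, t, ht, rfl⟩
    refine ⟨⟨t, ht⟩, ?_⟩
    rw [subgroup_smul_rmk, rmk_eq_rmk_iff]
    simpa using H.inv_mem hh

/-- The orbit space `(H\G)/T` IS the double coset space `H\G/T`: the bijection. -/
noncomputable def orbitEquivDoubleCoset (T : Subgroup G) :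
    MulAction.orbitRel.Quotient T (RightCosets H) ≃ DoubleCoset.Quotient (H : Set G) (T : Set G) :=
  Equiv.ofBijective
    (fun q => Quotient.liftOn' q (fun c => Quotient.liftOn' c (DoubleCoset.mk H T) fun x y hxy =>
        (DoubleCoset.eq _ _ _ _).2 ⟨y * x⁻¹, (QuotientGroup.rightRel_apply).1 hxy, 1, T.one_mem,
          by group⟩)
      fun c d hcd => by
        revert hcd
        refine Quotient.inductionOn' c fun x => Quotient.inductionOn' d fun y hxy => ?_
        exact (orbitRel_iff H T x y).1 hxy)
    ⟨fun c d hcd => by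
      revert hcd
      refine Quotient.inductionOn' c fun c' => Quotient.inductionOn' d fun d' => ?_
      refine Quotient.inductionOn' c' fun x => Quotient.inductionOn' d' fun y hxy => ?_
      exact Quotient.sound' ((orbitRel_iff H T x y).2 hxy),
     fun d => by
      refine Quotient.inductionOn' d fun x => ?_
      exact ⟨Quotient.mk'' (rmk H x), rfl⟩⟩

/-- The bijection on classes. -/
theorem orbitEquivDoubleCoset_mk (T : Subgroup G) (x : G) :
    orbitEquivDoubleCoset H T (Quotient.mk'' (rmk H x)) = DoubleCoset.mk H T x :=
  rfl

/-- The inverse bijection on classes. -/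
theorem orbitEquivDoubleCoset_symm_mk (T : Subgroup G) (x : G) :
    (orbitEquivDoubleCoset H T).symm (DoubleCoset.mk H T x) = Quotient.mk'' (rmk H x) :=
  (orbitEquivDoubleCoset H T).symm_apply_eq.2 rfl

end Action

/-! ### Measurability and continuity -/

section Measurable

variable {G : Type*} [Group G] (H : Subgroup G)

/-- The quotient σ-algebra on the double coset space `H\G/T`. -/
instance instMeasurableSpaceDoubleCoset [MeasurableSpace G] (H T : Set G) :
    MeasurableSpace (DoubleCoset.Quotient (H : Set G) (T : Set G)) :=
  inferInstanceAs (MeasurableSpace (_root_.Quotient (DoubleCoset.setoid H T)))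

/-- A function on `H\G/T` is measurable iff its composite with the quotient map is. -/
theorem measurable_from_doubleCoset [MeasurableSpace G] {T : Subgroup G} {β : Type*}
    [MeasurableSpace β] {f : DoubleCoset.Quotient (H : Set G) (T : Set G) → β} :
    Measurable f ↔ Measurable (f ∘ DoubleCoset.mk H T) :=
  Iff.rfl

/-- The right regular action is measurable for the quotient σ-algebra. -/
instance instMeasurableConstSMul [MeasurableSpace G] [MeasurableMul G] :
    MeasurableConstSMul G (RightCosets H) where
  measurable_const_smul g :=
    measurable_from_quotient.2 (measurable_quotient_mk''.comp (measurable_mul_const g⁻¹))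

/-- `(H\G)/T ≃ H\G/T` as measurable spaces (quotient σ-algebras). -/
noncomputable def orbitMeasurableEquivDoubleCoset [MeasurableSpace G] (T : Subgroup G) :
    MulAction.orbitRel.Quotient T (RightCosets H) ≃ᵐ DoubleCoset.Quotient (H : Set G) (T : Set G) where
  toEquiv := orbitEquivDoubleCoset H T
  measurable_toFun := measurable_from_quotient.2 (measurable_from_quotient.2 measurable_quotient_mk'')
  measurable_invFun := by
    refine (measurable_from_doubleCoset H).2 ?_
    have h : (orbitEquivDoubleCoset H T).symm ∘ DoubleCoset.mk H T =
        fun x => Quotient.mk'' (rmk H x) := by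
      funext x
      exact orbitEquivDoubleCoset_symm_mk H T x
    rw [h]
    exact measurable_quotient_mk''.comp measurable_quotient_mk''

/-- `(H\G)/T ≃ₜ H\G/T` for the quotient topologies (row 39's topology on the double coset
space). -/
noncomputable def orbitHomeomorphDoubleCoset [TopologicalSpace G] (T : Subgroup G) :
    MulAction.orbitRel.Quotient T (RightCosets H) ≃ₜ DoubleCoset.Quotient (H : Set G) (T : Set G) where
  toEquiv := orbitEquivDoubleCoset H T
  continuous_toFun := Continuous.quotient_liftOn' (Continuous.quotient_liftOn' continuous_quotient_mk' _) _
  continuous_invFun := by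
    have h : ((orbitEquivDoubleCoset H T).symm : DoubleCoset.Quotient (H : Set G) (T : Set G) → _) =
        fun d => Quotient.liftOn' d (fun x => Quotient.mk'' (rmk H x)) fun x y hxy => by
          apply Quotient.sound'
          exact (orbitRel_iff H T x y).2 ((DoubleCoset.eq'' H T).2 hxy) := by
      funext d
      refine Quotient.inductionOn' d fun x => ?_
      exact orbitEquivDoubleCoset_symm_mk H T x
    show Continuous ((orbitEquivDoubleCoset H T).symm : DoubleCoset.Quotient (H : Set G) (T : Set G) → _)
    rw [h]
    exact Continuous.quotient_liftOn' (continuous_quotient_mk'.comp continuous_quotient_mk') _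

end Measurable

/-! ### The product case `G = A × B`: `A × {1}` and `{1} × K` commute -/

section Product

variable {A B : Type*} [Group A] [Group B] (H : Subgroup (A × B)) (K : Subgroup B)

/-- `A` acts on `H\(A × B)` through `A × {1}` (right regular action). -/
instance instMulActionInl : MulAction A (RightCosets H) :=
  MulAction.compHom _ (MonoidHom.inl A B)

/-- The `A`-action on classes. -/
theorem inl_smul_rmk (a : A) (x : A × B) :
    a • rmk H x = rmk H (x * MonoidHom.inl A B a⁻¹) := by
  rw [MulAction.compHom_smul_def, smul_rmk, map_inv]

/-- «G_∞ commutes with K_f»: the actions of `A` and of `{1} × K` on `H\(A × B)` commute. -/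
instance instSMulCommClass_inl_rightLevel : SMulCommClass A (rightLevel A K) (RightCosets H) where
  smul_comm a k q := by
    refine Quotient.inductionOn' q fun x => ?_
    rw [subgroup_smul_rmk, inl_smul_rmk, inl_smul_rmk, subgroup_smul_rmk, mul_assoc, mul_assoc,
      ← T5DoubleCosetTopology.rightLevel_mul_inl K (Subgroup.inv_mem _ k.2)]

/-- The dictionary is `A`-EQUIVARIANT: row 43's induced action of `A` on the orbit space
`(H\(A × B))/({1} × K)` corresponds to row 39's action of `A` on `FullQuotient H K`. -/
theorem orbitEquivDoubleCoset_smul (a : A)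
    (q : MulAction.orbitRel.Quotient (rightLevel A K) (RightCosets H)) :
    orbitEquivDoubleCoset H (rightLevel A K) (a • q) = a • orbitEquivDoubleCoset H (rightLevel A K) q := by
  refine Quotient.inductionOn' q fun c => ?_
  refine Quotient.inductionOn' c fun x => ?_
  show orbitEquivDoubleCoset H (rightLevel A K) (Quotient.mk'' (a • rmk H x)) = _
  rw [inl_smul_rmk, orbitEquivDoubleCoset_mk, orbitEquivDoubleCoset_mk,
    T5DoubleCosetTopology.smul_mk]

end Product

end Summit.Ventures.HodgeRepro2.T5RightCosetAction
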